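import Summits.BirchSwinnertonDyer.BirchSwinnertonDyer.Theorems.ThetaPartnerAtTwoSignedControlAtTwoMuRealCardSqTotallyComplex
import Summits.BirchSwinnertonDyer.BirchSwinnertonDyer.Theorems.KolyvaginRoadThreePTSelmerComplementAtOfMiddleExact
import Mathlib.NumberTheory.NumberField.InfinitePlace.TotallyRealComplex
import HarnessLib

/-!
# Poitou–Tate duality for Selmer structures (Howard 2004 Thm. 2.1.11, both inclusions) AT every module of order `p²` killed by `p`
# — in particular AT `E[p]` — over a TOTALLY COMPLEX number field, EVERY prime `p` (incl. `p = 2`)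

Route `ThetaPartnerAtTwo`, crux K4 `SignedControlAtTwo` (stmt-BirchSwinnertonDyer-20309), line `eulerchar` v11, lead `bsd-wall-tp2-p3` g4
(`--supports stmt-BirchSwinnertonDyer-20309`, helper).  File 11 of the real-place packet: the consumable (`SelmerComplement`-body) form of
file 10 (`middleExact_canonical_of_card_eq_sq_of_isTotallyComplex`) through bsd-stepL koly3b's `PTAt.selmerComplementAt_canonical_of_middleExact`
— koly's `selmerComplementAt_canonical_torsionGaloisModule (hodd)` with `Odd p` replaced by `IsTotallyComplex K`.

* `selmerComplementAt_canonical_of_card_eq_sq_of_isTotallyComplex` — any `M` with `#M = p²`, `p·M = 0`;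
* `selmerComplementAt_canonical_torsionGaloisModule_of_isTotallyComplex` — `M = E[p]` for every elliptic `E/K`: e.g. the `2`-descent
  Selmer structures on `E[2]` over an imaginary quadratic field (Heegner / Kolyvagin-at-2 settings) no longer need the ∀-module fact
  `poitouTate_selmerStructure_duality K` at this module.

HONEST FRAMING. THEOREMS ONLY; one-line packagings; per-module; no item closes; BSD is not proved by any of this.

References: [Howard2004HeegnerKolyvagin] Thm. 2.1.11; [MilneADT2006] I Thm. 4.10(b); [SilvermanAEC2009] III.6.4.
-/

noncomputable section

open CategoryTheory Function NumberField IsDedekindDomain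
open scoped NumberField ContRepresentation

set_option linter.dupNamespace false
set_option autoImplicit false

namespace Summit.BirchSwinnertonDyer.BirchSwinnertonDyer.Theorems.SignedEC.MuReal

open Field
open Literature.NumberTheory.GaloisRepresentations Literature.NumberTheory.GaloisCohomology
open Literature.NumberTheory.GaloisRepresentations.DiscreteGaloisModule (mu MuCarrier TateDual tateDual
  localTatePairingZMod unramifiedSubgroup SelmerStructure)
open _root_.TopRep _root_.ContRepresentation _root_.ContinuousCohomology
open Summit.BirchSwinnertonDyer.Rank1Residual.X11b.Three.Koly
open Literature.NumberTheory.EllipticCurves WeierstrassCurve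

variable {K : Type} [Field K] [NumberField K] {p : ℕ} [hp : Fact p.Prime]

/-- **Howard's Thm. 2.1.11 AT every `M` of order `p²` killed by `p` over a totally complex `K`, every prime `p`**, THE canonical maps at
level `p`, every admissible `S`, every pair `𝓕 ≤ 𝓖` unramified outside `S`. [cite: Howard2004HeegnerKolyvagin, Thm. 2.1.11 (arXiv:1202.6340 p. 6)]
[cite: MilneADT2006, Ch. I, Thm. 4.10(b)] -/
theorem selmerComplementAt_canonical_of_card_eq_sq_of_isTotallyComplex [IsTotallyComplex K]
    {M : Type} [AddCommGroup M] [TopologicalSpace M] [DiscreteTopology M] [Finite M]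
    (ρ : DiscreteGaloisModule K M) (hpM : ∀ m : M, p • m = 0) (hcard : Nat.card M = p ^ 2) :
    haveI : NeZero p := ⟨hp.out.ne_zero⟩
    ∀ (S : Finset (Place K)),
      (∀ v : HeightOneSpectrum (𝓞 K), (Sum.inr v : Place K) ∉ S →
        ((p : ℕ) : 𝓞 K) ∉ v.asIdeal ∧ GaloisRep.IsUnramifiedAt v ρ) →
    ∀ (𝓕 𝓖 : SelmerStructure ρ), 𝓕 ≤ 𝓖 → 𝓕.IsUnramifiedOutside S → 𝓖.IsUnramifiedOutside S →
      (∀ t : Π v : Place K, galoisCohomology (ρ.toLocal v) 1, (∀ v ∈ S, t v ∈ 𝓖 v) →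
        (∀ y ∈ ((LocalInvariants.canonical K p).dualSelmerStructure ρ 𝓕).selmerGroup,
          ∑ v ∈ S, localTatePairingZMod ρ p v (LocalInvariants.canonical K p v) (t v)
            (galoisCohomology.localization (ρ.tateDual p) v 1 y) = 0) →
        ∃ x ∈ 𝓖.selmerGroup, ∀ v ∈ S, galoisCohomology.localization ρ v 1 x - t v ∈ 𝓕 v) ∧
      (∀ u : Π v : Place K, galoisCohomology ((ρ.tateDual p).toLocal v) 1,
        (∀ v ∈ S, u v ∈ (LocalInvariants.canonical K p).dualSelmerStructure ρ 𝓕 v) →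
        (∀ x ∈ 𝓖.selmerGroup,
          ∑ v ∈ S, localTatePairingZMod ρ p v (LocalInvariants.canonical K p v)
            (galoisCohomology.localization ρ v 1 x) (u v) = 0) →
        ∃ y ∈ ((LocalInvariants.canonical K p).dualSelmerStructure ρ 𝓕).selmerGroup,
          ∀ v ∈ S, galoisCohomology.localization (ρ.tateDual p) v 1 y - u v ∈
            (LocalInvariants.canonical K p).dualSelmerStructure ρ 𝓖 v) := by
  haveI : NeZero p := ⟨hp.out.ne_zero⟩
  exact PTAt.selmerComplementAt_canonical_of_middleExact p hp.out.isPrimePow ρ hpM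
    (fun _ _ hS t horth => middleExact_canonical_of_card_eq_sq_of_isTotallyComplex ρ hpM hcard hS t horth)

/-- **Howard's Thm. 2.1.11 AT `E[p]` over a totally complex number field, every prime `p` (incl. `2`), every elliptic `E/K`**, THE
canonical maps at level `p`: koly's `selmerComplementAt_canonical_torsionGaloisModule` without `Odd p`.
[cite: Howard2004HeegnerKolyvagin, Thm. 2.1.11 (arXiv:1202.6340 p. 6)] [cite: MilneADT2006, Ch. I, Thm. 4.10(b)] [cite: SilvermanAEC2009, Cor. III.6.4(b)] -/
theorem selmerComplementAt_canonical_torsionGaloisModule_of_isTotallyComplex [IsTotallyComplex K] (W : WeierstrassCurve K)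
    [W.IsElliptic] [Finite (geomTorsion W (p : ℤ))] :
    haveI : NeZero p := ⟨hp.out.ne_zero⟩
    ∀ (S : Finset (Place K)),
      (∀ v : HeightOneSpectrum (𝓞 K), (Sum.inr v : Place K) ∉ S →
        ((p : ℕ) : 𝓞 K) ∉ v.asIdeal ∧ GaloisRep.IsUnramifiedAt v (W.torsionGaloisModule (p : ℤ))) →
    ∀ (𝓕 𝓖 : SelmerStructure (W.torsionGaloisModule (p : ℤ))), 𝓕 ≤ 𝓖 → 𝓕.IsUnramifiedOutside S →
      𝓖.IsUnramifiedOutside S →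
      (∀ t : Π v : Place K, galoisCohomology ((W.torsionGaloisModule (p : ℤ)).toLocal v) 1, (∀ v ∈ S, t v ∈ 𝓖 v) →
        (∀ y ∈ ((LocalInvariants.canonical K p).dualSelmerStructure (W.torsionGaloisModule (p : ℤ)) 𝓕).selmerGroup,
          ∑ v ∈ S, localTatePairingZMod (W.torsionGaloisModule (p : ℤ)) p v (LocalInvariants.canonical K p v) (t v)
            (galoisCohomology.localization ((W.torsionGaloisModule (p : ℤ)).tateDual p) v 1 y) = 0) →
        ∃ x ∈ 𝓖.selmerGroup, ∀ v ∈ S,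
          galoisCohomology.localization (W.torsionGaloisModule (p : ℤ)) v 1 x - t v ∈ 𝓕 v) ∧
      (∀ u : Π v : Place K, galoisCohomology (((W.torsionGaloisModule (p : ℤ)).tateDual p).toLocal v) 1,
        (∀ v ∈ S, u v ∈ (LocalInvariants.canonical K p).dualSelmerStructure (W.torsionGaloisModule (p : ℤ)) 𝓕 v) →
        (∀ x ∈ 𝓖.selmerGroup,
          ∑ v ∈ S, localTatePairingZMod (W.torsionGaloisModule (p : ℤ)) p v (LocalInvariants.canonical K p v)
            (galoisCohomology.localization (W.torsionGaloisModule (p : ℤ)) v 1 x) (u v) = 0) →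
        ∃ y ∈ ((LocalInvariants.canonical K p).dualSelmerStructure (W.torsionGaloisModule (p : ℤ)) 𝓕).selmerGroup,
          ∀ v ∈ S, galoisCohomology.localization ((W.torsionGaloisModule (p : ℤ)).tateDual p) v 1 y - u v ∈
            (LocalInvariants.canonical K p).dualSelmerStructure (W.torsionGaloisModule (p : ℤ)) 𝓖 v) := by
  haveI : NeZero p := ⟨hp.out.ne_zero⟩
  exact PTAt.selmerComplementAt_canonical_of_middleExact p hp.out.isPrimePow (W.torsionGaloisModule (p : ℤ))
    (fun P => Subtype.ext (by
      have h := (mem_geomTorsion_iff W (p : ℤ) (P : geomPoints W)).mp P.2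
      rw [natCast_zsmul] at h
      exact h))
    (fun _ _ hS t horth => middleExact_canonical_torsionGaloisModule_of_isTotallyComplex W hS t horth)

end Summit.BirchSwinnertonDyer.BirchSwinnertonDyer.Theorems.SignedEC.MuReal

end
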